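import Mathlib.CategoryTheory.Whiskering
import Literature.IUT.LogThetaLattice.BiCores
import Literature.IUT.LogThetaLattice.HodgeTheaterLogLink
import Literature.IUT.LogThetaLattice.ThetaMonoids
import Literature.IUT.LogThetaLattice.RadialData
import HarnessLib

/-!
# [IUTchIII] §1–§2: ONE set of objects — the identifications between the §1–§2 interface files

Mochizuki, *Inter-universal Teichmüller Theory III*, kurims manuscript (May 2020), §1–§2
[cite: Mochizuki2012, III Def 1.4 p.45, Thm 1.5 (ii)(iii) pp.48–50, Prop 2.1 (ii)(vi) pp.58–61, Cor 2.3 p.72]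
and *Inter-universal Teichmüller Theory II* Def 4.9 (vi)–(viii) pp.156–158, Cor 4.10 (i)(ii)(iv) pp.158–160
(D-0012 claim key, status disputed; INTERFACE glue, nothing asserted).

WHY THIS FILE. The [IUTchIII] §1–§2 statement files of this directory were landed one printed item per file
with imports kept at depth 1, so the SAME printed functorial algorithm is carried by several interfaces:

| printed object | copies in the tree |
|---|---|
| `†HT ↦ †F^{⊢×μ}_△` (Frobenius-like; Thm 1.5 (ii), [IUTchII] Cor 4.10 (iv)) | `ThetaLinkData.fxmDelta` (`HodgeTheaterLogLink`), `BiCoricData.fxmDeltaHT` (`BiCores`) |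
| `†HT^D ↦ †D^⊢_△`, `†D^⊢ ↦ F^{⊢×μ}(†D^⊢)`, `D^⊢(F^{⊢×μ}(†D^⊢)) = †D^⊢` (Thm 1.5 (iii); [IUTchII] Cor 4.10 (i), 4.5 (ii)) | `BiCoricData.dvDelta/fxmOfDv/fxmOfDv_dv` (`BiCores`), `ThetaCoricData.dvDelta/fxmOfDv/fxmOfDv_dv` (`RadialData`) |
| `†HT^D ↦ F^{⊢×μ}_△(†D^⊢_△)` (Thm 1.5 (iii), Prop 2.1 (vi)) | `BiCoricData.dvDelta ⋙ fxmOfDv`, `ThetaCoricData.fxmDelta`, `ThetaMonoidData.fxmDeltaD` (`ThetaMonoids`) |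
| `†HT^D ↦ F^⊩_{env}(†D_>)` (Prop 2.1 (ii)) | `ThetaCoricData.fglEnv`, `S.dstrip gt ⋙ ThetaMonoidData.FglEnvD` |
| `†HT ↦ †F^{⊩▶×μ}_{env}` ([IUTchII] Cor 4.10 (ii)) | `ThetaLinkData.pilotTheta .nonGaussian`, `ThetaMonoidData.FglEnvHT ⋙ S.FglToFglxm` |
| `F^⊩ ↦ F^{⊢×μ}` ([IUTchII] Def 4.9 (vi)–(viii)) | `S.FglToFglxm ⋙ S.FglxmToFxm` (via `F^{⊩▶×μ}`), `S.FglToFv ⋙ S.FvToFxm` (via `F^⊢`) |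

The print has ONE object in each row. `LatticeGlue S` records this: one instance of each interface
together with the identification ISOMORPHISMS between the copies (natural isomorphisms of functors — what
"functorial algorithm … naturally isomorphic" gives; no equality of functors is imposed) and the one
coherence law relating the two identifications `D^⊢(F^{⊢×μ}(†D^⊢)) = †D^⊢`. Requested by abc-iut-c312-1
(INBOX 2026-08-25T21:15:08Z: `Thm311LinkLattice.LinkData.ofBiCoric` takes `Fenv`/`nat` as arguments
"an `Iso` between the two copies, or one shared field, would let me drop that argument") — `envNat` below
is that `nat`. Derived: the Kummer isomorphism on the `ThetaLinkData` copy (`kummerT`), the Prop 2.1 (vi)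
natural isomorphism on the `BiCoricData` copy (`envNat`), the agreement of the two routes
`F^⊩_{env} ↦ F^{⊢×μ}_{env}` (`fxmEnv_iso`), and the correspondence of the two `dvIso`s (`dvIso_eq`).
Deliberately NOT here: any new mathematical claim; the Gaussian pilot `†F^⊩_{gau}` ([IUTchII] Cor 4.10 (ii),
[IUTchIII] Def 3.8) has no §2 copy to be glued to.
-/

namespace Literature.IUT.LogThetaLattice

open CategoryTheory
open Literature.IUT.HodgeTheaters

universe u

/-- **IUTchIII:Thm1.5(iii)** (kurims p.49) GLUE of the [IUTchIII] §1–§2 interfaces over one frame: one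
`LogStripData`, `ThetaLinkData`, `BiCoricData`, `ThetaMonoidData`, `ThetaCoricData`, with the identification
isomorphisms between the copies of the same printed functorial algorithm (table in the module docstring)
and the route compatibility `F^⊩ ↦ F^{⊩▶×μ} ↦ F^{⊢×μ} = F^⊩ ↦ F^⊢ ↦ F^{⊢×μ}` of [IUTchII] Def 4.9 (vi)–(viii).
[claim: Mochizuki2012, status: disputed] -/
structure LatticeGlue (S : StripFrame.{u}) where
  /-- Def 1.1: `†F ↦ log(†F)` -/
  logData : LogStripData S
  /-- [IUTchII] Cor 4.10: the `Θ^{×μ}`-link / `Θ^{×μ}_{gau}`-link data -/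
  linkData : ThetaLinkData S
  /-- Def 1.1 (iv)–(vi), Prop 1.2 (vi)–(ix), Thm 1.5 (iii)–(v): log-shell / bi-core data -/
  biCoric : BiCoricData S
  /-- Prop 2.1, Thm 2.2: theta-monoid data -/
  thetaMonoid : ThetaMonoidData S
  /-- Cor 2.3: the radial/coric inputs -/
  coric : ThetaCoricData S
  /-- [IUTchII] Def 4.9 (vi)–(viii) p.156–158: the `F^{⊢×μ}`-prime-strip of the `F^{⊩▶×μ}`-prime-strip of `*F^⊩`
  IS the `F^{⊢×μ}`-prime-strip of the `F^⊢`-prime-strip `*F^⊢` underlying `*F^⊩` (one object in print;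
  the frame `StripFrame` types the two routes separately) -/
  fglRoute_iso : S.FglToFglxm ⋙ S.FglxmToFxm ≅ S.FglToFv ⋙ S.FvToFxm
  /-- Thm 1.5 (ii) / [IUTchII] Cor 4.10 (iv): `BiCores`' copy of `†HT ↦ †F^{⊢×μ}_△` is `HodgeTheaterLogLink`'s -/
  fxmDeltaHT_iso : biCoric.fxmDeltaHT ≅ linkData.fxmDelta
  /-- Thm 1.5 (iii) / [IUTchII] Cor 4.10 (i): `RadialData`'s copy of `†HT^D ↦ †D^⊢_△` is `BiCores`' -/
  dvDelta_iso : coric.dvDelta ≅ biCoric.dvDelta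
  /-- [IUTchII] Cor 4.5 (ii): `RadialData`'s copy of `†D^⊢ ↦ F^{⊢×μ}(†D^⊢)` is `BiCores`' -/
  fxmOfDv_iso : coric.fxmOfDv ≅ biCoric.fxmOfDv
  /-- coherence: the two identifications `D^⊢(F^{⊢×μ}(†D^⊢)) = †D^⊢` correspond under `fxmOfDv_iso` -/
  fxmOfDv_dv_compat : Functor.isoWhiskerRight fxmOfDv_iso S.FxmToDv ≪≫ biCoric.fxmOfDv_dv = coric.fxmOfDv_dv
  /-- Thm 1.5 (iii) / Prop 2.1 (vi): `ThetaMonoids`' copy of `†HT^D ↦ F^{⊢×μ}_△(†D^⊢_△)` is `BiCores`' -/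
  fxmDeltaD_iso : thetaMonoid.fxmDeltaD ≅ biCoric.dvDelta ⋙ biCoric.fxmOfDv
  /-- Prop 2.1 (ii): `RadialData`'s copy of `†HT^D ↦ F^⊩_{env}(†D_>)` is `ThetaMonoids`' (through `†D_>`) -/
  fglEnv_iso : coric.fglEnv ≅ S.dstrip thetaMonoid.gt ⋙ thetaMonoid.FglEnvD
  /-- [IUTchII] Cor 4.10 (ii) / Def 4.9 (viii): the non-Gaussian pilot `†F^{⊩▶×μ}_{env}` of the link data is the
  `F^{⊩▶×μ}`-prime-strip of `ThetaMonoids`' Frobenius-like `†F^⊩_{env}` -/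
  pilotEnv_iso : linkData.pilotTheta LatticeKind.nonGaussian ≅ thetaMonoid.FglEnvHT ⋙ S.FglToFglxm

namespace LatticeGlue

variable {S : StripFrame.{u}} (G : LatticeGlue S)

/-- **IUTchIII:Thm1.5(iii)** (kurims p.50) the Kummer isomorphism `^{n,m}F^{⊢×μ}_△ ⥲ F^{⊢×μ}_△(^{n,m}D^⊢_△)` on
`HodgeTheaterLogLink`'s copy `ThetaLinkData.fxmDelta` of the Frobenius-like strip (transport of
`BiCoricData.kummer` along `fxmDeltaHT_iso`). [claim: Mochizuki2012, status: disputed] -/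
def kummerT : G.linkData.fxmDelta ≅ (S.htToD ⋙ G.biCoric.dvDelta) ⋙ G.biCoric.fxmOfDv :=
  G.fxmDeltaHT_iso.symm ≪≫ G.biCoric.kummer

/-- **IUTchIII:Thm1.5(iii)** (kurims p.50) at one Hodge theater: `kummerT` is `fxmDeltaHT_iso⁻¹` followed by
`BiCoricData.kummerAt`. [claim: Mochizuki2012, status: disputed] -/
theorem kummerT_app (X : S.HT) :
    G.kummerT.app X = (G.fxmDeltaHT_iso.app X).symm ≪≫ G.biCoric.kummerAt X := rfl

/-- **IUTchIII:Prop2.1(vi)** (kurims p.61) `†HT^D ↦ F^{⊢×μ}_{env}(†D_>)`, the `F^{⊢×μ}`-prime-strip associated to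
`F^⊩_{env}(†D_>)` through `F^{⊩▶×μ}_{env}` (the route of `ThetaMonoidData.unitPortionD`).
[claim: Mochizuki2012, status: disputed] -/
abbrev fxmEnvD : S.DHT ⥤ S.Fxm := S.dstrip G.thetaMonoid.gt ⋙ G.thetaMonoid.FglEnvD ⋙ S.FglToFglxm ⋙ S.FglxmToFxm

/-- **IUTchIII:Prop2.1(vi)** (kurims p.61) "natural isomorphisms … `F^{⊢×}_△(†D^⊢_△) ⥲ F^{⊢×}_{env}(†D_>)`" on
`BiCores`' copy `dvDelta ⋙ fxmOfDv` of `F^{⊢×μ}_△(†D^⊢_△)` — the argument `nat` (with `Fenv := fxmEnvD`) of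
abc-iut-c312-1's `Thm311LinkLattice.LinkData.ofBiCoric`. [claim: Mochizuki2012, status: disputed] -/
def envNat : G.biCoric.dvDelta ⋙ G.biCoric.fxmOfDv ≅ G.fxmEnvD :=
  G.fxmDeltaD_iso.symm ≪≫ G.thetaMonoid.unitPortionD

/-- **IUTchIII:Cor2.3** (kurims p.73) `RadialData`'s `F^{⊢×μ}_△(†D^⊢_△)` (`ThetaCoricData.fxmDelta`) is `BiCores`'
`dvDelta ⋙ fxmOfDv`. [claim: Mochizuki2012, status: disputed] -/
def fxmDeltaE_iso : G.coric.fxmDelta ≅ G.biCoric.dvDelta ⋙ G.biCoric.fxmOfDv :=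
  Functor.isoWhiskerRight G.dvDelta_iso G.coric.fxmOfDv ≪≫ Functor.isoWhiskerLeft G.biCoric.dvDelta G.fxmOfDv_iso

/-- **IUTchIII:Cor2.3** (kurims p.73) `RadialData`'s `F^{⊢×μ}_{env}(†D_>)` (`ThetaCoricData.fxmEnv`, routed through
`F^⊢`) is `ThetaMonoids`' `fxmEnvD` (routed through `F^{⊩▶×μ}`): the two routes agree by `fglRoute_iso`.
[claim: Mochizuki2012, status: disputed] -/
def fxmEnv_iso : G.coric.fxmEnv ≅ G.fxmEnvD :=
  Functor.isoWhiskerRight G.fglEnv_iso (S.FglToFv ⋙ S.FvToFxm) ≪≫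
    Functor.isoWhiskerLeft (S.dstrip G.thetaMonoid.gt ⋙ G.thetaMonoid.FglEnvD) G.fglRoute_iso.symm

/-- **IUTchIII:Cor2.3** (kurims p.73) hence ONE natural [poly-]isomorphism `F^{⊢×μ}_△(†D^⊢_△) ⥲ F^{⊢×μ}_{env}(†D_>)` on
`RadialData`'s objects (Cor 2.3 (e_ℜ)'s comparison), obtained from Prop 2.1 (vi) through the glue.
[claim: Mochizuki2012, status: disputed] -/
def envNatE : G.coric.fxmDelta ≅ G.coric.fxmEnv :=
  G.fxmDeltaE_iso ≪≫ G.envNat ≪≫ G.fxmEnv_iso.symm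

/-- **IUTchIII:Thm1.5(iii)** (kurims p.50) the coherence law at one object: `RadialData`'s `dvIso` is `BiCores`'
`dvIso` precomposed with `D^⊢(fxmOfDv_iso)`. [claim: Mochizuki2012, status: disputed] -/
theorem dvIso_eq (D : S.Dv) :
    G.coric.dvIso D = S.FxmToDv.mapIso (G.fxmOfDv_iso.app D) ≪≫ G.biCoric.dvIso D := by
  ext
  have h := congrArg (fun (e : G.coric.fxmOfDv ⋙ S.FxmToDv ≅ 𝟭 S.Dv) => e.hom.app D) G.fxmOfDv_dv_compat
  simp only [Iso.trans_hom, NatTrans.comp_app, Functor.isoWhiskerRight_hom, Functor.whiskerRight_app] at h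
  simp only [ThetaCoricData.dvIso, BiCoricData.dvIso, Iso.trans_hom, Functor.mapIso_hom, Iso.app_hom]
  exact h.symm

/-- **IUTchII:Cor4.10(ii)** (kurims p.159) the non-Gaussian link's pilot at one Hodge theater is the
`F^{⊩▶×μ}`-strip of `†F^⊩_{env}`. [claim: Mochizuki2012, status: disputed] -/
def pilotEnvAt (X : S.HT) :
    (G.linkData.pilotTheta LatticeKind.nonGaussian).obj X ≅ S.FglToFglxm.obj (G.thetaMonoid.FglEnvHT.obj X) :=
  G.pilotEnv_iso.app X

/-- **IUTchII:Cor4.10(iv)** (kurims p.160) the `F^{⊢×μ}`-prime-strip of the non-Gaussian pilot is, through the glue and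
`ThetaMonoidData.kummerFgl`, the étale-like `F^{⊢×μ}_{env}(†D_>)`: a natural isomorphism
`(†F^{⊩▶×μ}_{env})^{⊢×μ} ≅ F^{⊢×μ}_{env}(†D_>)` functorial in `†HT`. [claim: Mochizuki2012, status: disputed] -/
def pilotEnvFxm_iso :
    G.linkData.pilotTheta LatticeKind.nonGaussian ⋙ S.FglxmToFxm ≅ S.htToD ⋙ G.fxmEnvD :=
  Functor.isoWhiskerRight G.pilotEnv_iso S.FglxmToFxm ≪≫
    Functor.isoWhiskerRight (Functor.isoWhiskerRight G.thetaMonoid.kummerFgl S.FglToFglxm) S.FglxmToFxm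

end LatticeGlue

end Literature.IUT.LogThetaLattice
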